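import Literature.Geometry.Riemannian.LipschitzSmoothing
import Literature.Geometry.Riemannian.BakryEmeryHeatFlow
import Literature.Geometry.Lorentzian.VolumeProofs
import Literature.Geometry.Lorentzian.VolumePositivity
import Mathlib.MeasureTheory.Integral.Lebesgue.Add
import Mathlib.MeasureTheory.Measure.Prod
import HarnessLib

/-!
# From an isoperimetric inequality for the Minkowski content to the level-set (slab)
# inequality `∫_{t₁}^{t₂} I(vol{|u| > t}) dt ≤ ∫_{t₁ < |u| < t₂} |∇u| dvol` — without the coarea formula

Topic `Geometry/Riemannian`. Let `(M, g)` be a smooth Riemannian manifold (a Riemannian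
`PseudoRiemannianMetric` on `TM`, Riemannian distance `d = g.edist hg`, Riemannian measure
`μ = riemannianMeasure`), and suppose an **isoperimetric inequality for the (outer) Minkowski
content** is known: for every Borel `Ω` with compact closure,
`I(μ Ω) ≤ μ⁺(Ω) := liminf_{ε → 0⁺} μ(Ω_ε ∖ Ω)/ε`, `Ω_ε = {x | ∃ y ∈ Ω, d(x,y) < ε}`
(Balogh–Kristály, Math. Ann. 385 (2023), Thm. 1.1, is this statement on `CD(0,N)` spaces with
Euclidean volume growth, `I(v) = N ω_N^{1/N} AVR^{1/N} v^{(N-1)/N}`, for bounded Borel `Ω` and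
exactly this `m⁺`, `Ω_ε`; Brendle, CPAM 76 (2023) for domains in `Ric ≥ 0` manifolds). We PROVE that
then, for every smooth compactly supported `u : M → ℝ` and all levels `0 ≤ t₁ < t₂`,

  `∫_{t₁}^{t₂} I(μ{|u| > t}) dt ≤ ∫_{t₁ < |u| < t₂} |∇u|_g dμ`       (`lintegral` form),

the inequality through which isoperimetry enters every symmetrisation argument (Talenti 1976,
(29)–(32); Balogh–Kristály–Tripaldi 2024, §2.1–§3.1 via the Pólya–Szegő inequality of
Nobili–Violo) — classically obtained from the coarea formula and the isoperimetric inequality of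
a.e. superlevel set. The point of this file is that NO coarea formula is needed: the Minkowski
content of a superlevel set is controlled DIRECTLY by the measure of a thin slab,

  `{|u| > t}_ε ∖ {|u| > t} ⊆ {x | t − (|∇u|(x) + η) ε < |u x| ≤ t}`   (`ε ≤ δ(η)`),

because a point at distance `< ε` from `{|u| > t}` is joined to it by a path of length `< ε` along
which `|u|` varies at speed `≤ |∇u| ≤ |∇u|(x) + η` (upper gradient inequality
`abs_sub_le_mul_of_edist_lt` + uniform continuity of `|∇u|`); integrating in `t`, Tonelli gives
`∫_{t₁}^{t₂} μ{t − c(x) < |u| ≤ t} dt ≤ ∫_{t₁ − sup c < |u| < t₂} c dμ` with `c = (|∇u| + η) ε`, and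
Fatou's lemma along `ε → 0⁺` followed by `η → 0`, `t₁' ↓ t₁` yields the slab inequality.

* `abs_sub_le_mul_of_edist_lt` — **upper gradient inequality**: if `|∇u| ≤ L` on the `d`-ball
  `{z | d(x,z) < ε}` and `d(x,y) < ε` then `|u y − u x| ≤ L ε`;
* `exists_forall_edist_lt_sqrt_gradSq_le` — uniform continuity of `|∇u|` for smooth compactly
  supported `u`;
* `minkowskiShell_subset_slab` — the displayed inclusion;
* `lintegral_measure_slab_le` — the Tonelli step;
* `lintegral_isoperimetricProfile_le_lintegral_slab` — **the slab inequality** (main theorem).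

Everything is proved; no definitions, no named facts.

## References

* [BaloghKristaly2022] Z. M. Balogh, A. Kristály, *Sharp isoperimetric and Sobolev inequalities in
  spaces with nonnegative Ricci curvature*, Math. Ann. 385 (2023) 1747–1773 (arXiv:2012.11862),
  Thm. 1.1 and the definition of `m⁺(Ω) = liminf_{ε→0⁺} m(Ω_ε ∖ Ω)/ε`,
  `Ω_ε = {x : ∃ y ∈ Ω, d(x,y) < ε}` preceding it (p. 3 of the arXiv text). READ.
* [Brendle2022] S. Brendle, *Sobolev inequalities in manifolds with nonnegative curvature*, Comm.
  Pure Appl. Math. 76 (2023) 2192–2218 (the smooth case).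
* [BaloghKristalyTripaldi2024] Z. M. Balogh, A. Kristály, F. Tripaldi, J. Funct. Anal. 286 (2024)
  110217, §2.1 ((2.1), definition of `m⁺` and `Ω_ε`), §3.1.
* G. Talenti, *Best constant in Sobolev inequality*, Ann. Mat. Pura Appl. 110 (1976), (29)–(32)
  (the level-set inequality from coarea + isoperimetry).
-/

noncomputable section

open Bundle Set Function Filter Manifold MeasureTheory Metric
open scoped Manifold ContDiff Topology ENNReal NNReal

namespace Literature.Geometry.Riemannian

open Lorentzian

section UpperGradient

variable {E : Type*} [NormedAddCommGroup E] [NormedSpace ℝ E] [FiniteDimensional ℝ E]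
  {H : Type*} [TopologicalSpace H] {I : ModelWithCorners ℝ E H}
  {M : Type*} [TopologicalSpace M] [ChartedSpace H M] [IsManifold I ∞ M]
  (g : PseudoRiemannianMetric I ∞ E (TangentSpace I : M → Type _))

set_option backward.isDefEq.respectTransparency false in
/-- **Upper gradient inequality.** For a `C¹` function `u` on a Riemannian manifold, if
`|∇u|_g ≤ L` on the distance ball `{z | d(x,z) < ε}` and `d(x,y) < ε`, then `|u y − u x| ≤ L ε`:
join `x` to `y` by a `C¹` path `γ` of length `< ε` (it stays in the ball), and integrate
`|(u ∘ γ)'| = |du(γ')| ≤ |∇u| |γ'| ≤ L |γ'|` (Cauchy–Schwarz `abs_mvfderiv_le_sqrt_gradSq_mul_sqrt`).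
[folklore] -/
theorem abs_sub_le_mul_of_edist_lt (hg : g.IsRiemannian) {u : M → ℝ}
    (hu : ContMDiff I 𝓘(ℝ, ℝ) 1 u) {x y : M} {L ε : ℝ} (hL : 0 ≤ L)
    (hxy : g.edist hg x y < ENNReal.ofReal ε)
    (hgrad : ∀ z, g.edist hg x z < ENNReal.ofReal ε → Real.sqrt (g.gradSq u z) ≤ L) :
    |u y - u x| ≤ L * ε := by
  letI := g.riemannianBundle hg
  have hε : 0 ≤ ε := by
    by_contra hneg
    rw [not_le] at hneg
    rw [ENNReal.ofReal_of_nonpos hneg.le] at hxy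
    exact ENNReal.not_lt_zero hxy
  have hxy' : riemannianEDist I x y < ENNReal.ofReal ε := hxy
  obtain ⟨γ, hγ0, hγ1, γ_smooth, hγlen, -, -⟩ :=
    exists_lt_locally_constant_of_riemannianEDist_lt hxy' zero_lt_one
  -- every point of the path is `ε`-close to `x`
  have hclose : ∀ s ∈ Icc (0 : ℝ) 1, g.edist hg x (γ s) < ENNReal.ofReal ε := by
    intro s hs
    calc g.edist hg x (γ s) = riemannianEDist I x (γ s) := rfl
      _ ≤ pathELength I γ 0 s :=
          riemannianEDist_le_pathELength (γ_smooth.contMDiffOn (s := Icc 0 s)) hγ0 rfl hs.1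
      _ ≤ pathELength I γ 0 1 := pathELength_mono le_rfl hs.2
      _ < ENNReal.ofReal ε := hγlen
  -- `f = u ∘ γ` is `C¹`
  set f : ℝ → ℝ := u ∘ γ with hf_def
  have hf : CMDiff 1 f := hu.comp γ_smooth
  have hf' : ContDiff ℝ 1 f := contMDiff_iff_contDiff.1 hf
  have h1 : ‖f 1 - f 0‖ₑ ≤ ∫⁻ s in Icc (0 : ℝ) 1, ‖derivWithin f (Icc 0 1) s‖ₑ :=
    enorm_sub_le_lintegral_derivWithin_Icc_of_contDiffOn_Icc hf'.contDiffOn zero_le_one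
  -- pointwise: `|(u ∘ γ)'(s)| ≤ L |γ'(s)|`
  have h2 : ∀ s ∈ Icc (0 : ℝ) 1,
      ‖derivWithin f (Icc 0 1) s‖ₑ ≤ ENNReal.ofReal L * ‖mfderiv[Icc 0 1] γ s 1‖ₑ := by
    intro s hs
    have hs01 : (0 : ℝ) < 1 := zero_lt_one
    have e1 : derivWithin f (Icc 0 1) s = mfderiv[Icc 0 1] f s 1 := by
      rw [mfderivWithin_eq_fderivWithin]
      rfl
    have e2 : mfderiv[Icc 0 1] f s = (mfderiv% u (γ s)) ∘L (mfderiv[Icc 0 1] γ s) := by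
      apply mfderiv_comp_mfderivWithin
      · exact hu.mdifferentiableAt one_ne_zero
      · exact (γ_smooth.mdifferentiable one_ne_zero).mdifferentiableOn _ hs
      · rw [uniqueMDiffWithinAt_iff_uniqueDiffWithinAt]
        exact uniqueDiffOn_Icc hs01 _ hs
    have e3 : mfderiv[Icc 0 1] f s 1 = (mfderiv% u (γ s)) (mfderiv[Icc 0 1] γ s 1) := by
      rw [e2]
      rfl
    set v : TangentSpace I (γ s) := mfderiv[Icc 0 1] γ s 1 with hv
    -- Cauchy–Schwarz for the differential
    have hCS := abs_mvfderiv_le_sqrt_gradSq_mul_sqrt g hg u (γ s) v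
    have hmv : mvfderiv I u (γ s) v = (mfderiv% u (γ s)) v := rfl
    have hnv : Real.sqrt (g.val (γ s) v v) = ‖v‖ := (g.norm_eq_sqrt hg (γ s) v).symm
    rw [hmv, hnv] at hCS
    have hL' : Real.sqrt (g.gradSq u (γ s)) ≤ L := hgrad _ (hclose s hs)
    have hreal : |derivWithin f (Icc 0 1) s| ≤ L * ‖v‖ := by
      rw [e1, e3]
      exact hCS.trans (mul_le_mul_of_nonneg_right hL' (norm_nonneg _))
    calc ‖derivWithin f (Icc 0 1) s‖ₑ = ENNReal.ofReal |derivWithin f (Icc 0 1) s| :=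
          Real.enorm_eq_ofReal_abs _
      _ ≤ ENNReal.ofReal (L * ‖v‖) := ENNReal.ofReal_le_ofReal hreal
      _ = ENNReal.ofReal L * ‖v‖ₑ := by
          rw [ENNReal.ofReal_mul hL, ofReal_norm]
  -- integrate
  have h3 : ∫⁻ s in Icc (0 : ℝ) 1, ‖derivWithin f (Icc 0 1) s‖ₑ ≤
      ENNReal.ofReal L * ENNReal.ofReal ε := by
    calc ∫⁻ s in Icc (0 : ℝ) 1, ‖derivWithin f (Icc 0 1) s‖ₑ
        ≤ ∫⁻ s in Icc (0 : ℝ) 1, ENNReal.ofReal L * ‖mfderiv[Icc 0 1] γ s 1‖ₑ :=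
          setLIntegral_mono' measurableSet_Icc h2
      _ = ENNReal.ofReal L * pathELength I γ 0 1 := by
          rw [lintegral_const_mul' _ _ ENNReal.ofReal_ne_top,
            pathELength_eq_lintegral_mfderivWithin_Icc]
      _ ≤ ENNReal.ofReal L * ENNReal.ofReal ε := by gcongr
  have h4 : ‖f 1 - f 0‖ₑ ≤ ENNReal.ofReal (L * ε) := by
    rw [ENNReal.ofReal_mul hL]
    exact h1.trans h3
  rw [← ofReal_norm, ENNReal.ofReal_le_ofReal_iff (mul_nonneg hL hε),
    Real.norm_eq_abs] at h4
  simpa [hf_def, hγ0, hγ1] using h4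

/-- **The Minkowski shell of a superlevel set lies in a thin slab.** If `|∇u|(z) ≤ |∇u|(x) + η`
whenever `d(x,z) < ε` (uniform continuity of `|∇u|` at scale `ε`), then for every level `t`,
`{x | ∃ y, |u y| > t, d(x,y) < ε} ∖ {|u| > t} ⊆ {x | t − (|∇u|(x) + η) ε < |u x| ≤ t}`
(`abs_sub_le_mul_of_edist_lt` with `L = |∇u|(x) + η`, and `||u y| − |u x|| ≤ |u y − u x|`).
[folklore] -/
theorem minkowskiShell_subset_slab (hg : g.IsRiemannian) {u : M → ℝ}
    (hu : ContMDiff I 𝓘(ℝ, ℝ) 1 u) {ε η : ℝ} (hη : 0 ≤ η)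
    (hUC : ∀ x z, g.edist hg x z < ENNReal.ofReal ε →
      Real.sqrt (g.gradSq u z) ≤ Real.sqrt (g.gradSq u x) + η) (t : ℝ) :
    {x | ∃ y, t < |u y| ∧ g.edist hg x y < ENNReal.ofReal ε} \ {x | t < |u x|} ⊆
      {x | t - (Real.sqrt (g.gradSq u x) + η) * ε < |u x| ∧ |u x| ≤ t} := by
  rintro x ⟨⟨y, hyt, hxy⟩, hxt⟩
  have hL : 0 ≤ Real.sqrt (g.gradSq u x) + η := add_nonneg (Real.sqrt_nonneg _) hη
  have hlip := abs_sub_le_mul_of_edist_lt g hg hu hL hxy (fun z hz ↦ hUC x z hz)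
  refine ⟨?_, not_lt.1 hxt⟩
  have : |u y| - |u x| ≤ |u y - u x| := abs_sub_abs_le_abs_sub _ _
  linarith

end UpperGradient

/-! ### Uniform continuity of `|∇u|` and the Tonelli step -/

section Slab

variable {E : Type*} [NormedAddCommGroup E] [NormedSpace ℝ E] [FiniteDimensional ℝ E]
  {H : Type*} [TopologicalSpace H] {I : ModelWithCorners ℝ E H} [I.Boundaryless]
  {M : Type*} [TopologicalSpace M] [ChartedSpace H M] [IsManifold I ∞ M]
  (g : PseudoRiemannianMetric I ∞ E (TangentSpace I : M → Type _))

omit [I.Boundaryless] in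
/-- `|∇u|²_g` vanishes off the topological support of `u` (a general-model copy of the
`EuclideanSpace` version in `SharpLogSobolevAVRProofs.lean`; private to this file). [folklore] -/
private theorem gradSq_eq_zero_of_notMem_tsupport_of_boundaryless {u : M → ℝ} {x : M}
    (hx : x ∉ tsupport u) : g.gradSq u x = 0 := by
  have hu : u =ᶠ[𝓝 x] fun _ ↦ (0 : ℝ) := notMem_tsupport_iff_eventuallyEq.1 hx
  have h1 : mfderiv% u x = 0 := by
    rw [hu.mfderiv_eq]
    exact mfderiv_const
  have hd : mvfderiv I u x = 0 := by
    simp only [mvfderiv, h1, ContinuousLinearMap.comp_zero]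
  simp [PseudoRiemannianMetric.gradSq, PseudoRiemannianMetric.innerDual, hd]

/-- **Uniform continuity of `|∇u|` for a smooth compactly supported `u`**, in the Riemannian
distance: for every `η > 0` there is `δ > 0` with `|∇u|(z) ≤ |∇u|(x) + η` whenever `d(x,z) < δ`
(`|∇u| = (g.gradSq u)^{1/2}` is continuous with compact support; Heine–Cantor for the length
pseudo-emetric structure, whose topology is the manifold topology). [folklore] -/
theorem exists_forall_edist_lt_sqrt_gradSq_le [RegularSpace M] (hg : g.IsRiemannian)
    {u : M → ℝ} (hu : ContMDiff I 𝓘(ℝ, ℝ) ∞ u) (hcu : HasCompactSupport u) {η : ℝ} (hη : 0 < η) :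
    ∃ δ : ℝ, 0 < δ ∧ ∀ x z, g.edist hg x z < ENNReal.ofReal δ →
      Real.sqrt (g.gradSq u z) ≤ Real.sqrt (g.gradSq u x) + η := by
  letI := g.riemannianBundle hg
  haveI := g.isContinuousRiemannianBundle hg
  letI : PseudoEMetricSpace M := .ofRiemannianMetric I M
  set ρ : M → ℝ := fun z ↦ Real.sqrt (g.gradSq u z) with hρ
  have hρc : Continuous ρ := Real.continuous_sqrt.comp (contMDiff_gradSq g hu).continuous
  have hρs : HasCompactSupport ρ := by
    refine hcu.mono' fun x hx ↦ ?_
    by_contra hx'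
    apply hx
    change Real.sqrt (g.gradSq u x) = 0
    rw [gradSq_eq_zero_of_notMem_tsupport_of_boundaryless g hx', Real.sqrt_zero]
  have hUC : UniformContinuous ρ :=
    hρc.uniformContinuous_of_tendsto_cocompact hρs.is_zero_at_infty
  rw [EMetric.uniformContinuous_iff] at hUC
  obtain ⟨δ, hδ, hδU⟩ := hUC (ENNReal.ofReal η) (ENNReal.ofReal_pos.2 hη)
  obtain ⟨r, hr0, hrδ⟩ := ENNReal.lt_iff_exists_nnreal_btwn.1 hδ
  refine ⟨r, by exact_mod_cast hr0, fun x z hxz ↦ ?_⟩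
  have hxz' : edist x z < δ := by
    have : g.edist hg x z = edist x z := rfl
    rw [← this]
    exact lt_trans (by rwa [ENNReal.ofReal_coe_nnreal] at hxz) hrδ
  have h := hδU hxz'
  rw [edist_lt_ofReal, Real.dist_eq] at h
  have h' : ρ z - ρ x ≤ |ρ x - ρ z| := by
    rw [abs_sub_comm]
    exact le_abs_self _
  change ρ z ≤ ρ x + η
  linarith

omit [FiniteDimensional ℝ E] [I.Boundaryless] [IsManifold I ∞ M] in
/-- **The Tonelli step.** For measurable `w, c : X → ℝ` on an s-finite measure space and levels
`t₁ < t₂`: `∫_{t₁}^{t₂} μ{x | t − c x < w x ≤ t} dt ≤ ∫_{t₁ − c x < w x < t₂} c x dμ(x)` — swap the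
integrals; for fixed `x` the set of `t ∈ (t₁, t₂)` with `w x ≤ t < w x + c x` has length `≤ c x`
and is empty unless `t₁ − c x < w x < t₂`. [folklore] -/
theorem lintegral_measure_slab_le {X : Type*} [MeasurableSpace X] (μ : Measure X) [SFinite μ]
    {w c : X → ℝ} (hw : Measurable w) (hc : Measurable c) (t₁ t₂ : ℝ) :
    ∫⁻ t in Ioo t₁ t₂, μ {x | t - c x < w x ∧ w x ≤ t} ≤
      ∫⁻ x in {x | t₁ - c x < w x ∧ w x < t₂}, ENNReal.ofReal (c x) ∂μ := by
  set S : Set (ℝ × X) := {p | p.1 - c p.2 < w p.2 ∧ w p.2 ≤ p.1} with hS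
  have hSm : MeasurableSet S :=
    (measurableSet_lt (measurable_fst.sub (hc.comp measurable_snd)) (hw.comp measurable_snd)).inter
      (measurableSet_le (hw.comp measurable_snd) measurable_fst)
  have hAm : MeasurableSet {x | t₁ - c x < w x ∧ w x < t₂} :=
    (measurableSet_lt (measurable_const.sub hc) hw).inter (measurableSet_lt hw measurable_const)
  have h1 : ∀ t, μ {x | t - c x < w x ∧ w x ≤ t} = ∫⁻ x, S.indicator 1 (t, x) ∂μ := by
    intro t
    have hpre : MeasurableSet (Prod.mk t ⁻¹' S) := measurable_prodMk_left hSm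
    change μ (Prod.mk t ⁻¹' S) = _
    rw [← lintegral_indicator_one hpre]
    rfl
  simp_rw [h1]
  have hF : AEMeasurable (uncurry fun (t : ℝ) (x : X) ↦ S.indicator (1 : ℝ × X → ℝ≥0∞) (t, x))
      ((volume.restrict (Ioo t₁ t₂)).prod μ) :=
    (measurable_one.indicator hSm).aemeasurable
  rw [lintegral_lintegral_swap hF, ← lintegral_indicator hAm]
  refine lintegral_mono fun x ↦ ?_
  by_cases hx : x ∈ {x | t₁ - c x < w x ∧ w x < t₂}
  · rw [indicator_of_mem hx]
    calc ∫⁻ t in Ioo t₁ t₂, S.indicator 1 (t, x)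
        ≤ ∫⁻ t in Ioo t₁ t₂, (Ico (w x) (w x + c x)).indicator 1 t := by
          refine lintegral_mono fun t ↦ ?_
          by_cases ht : (t, x) ∈ S
          · have ht' : t ∈ Ico (w x) (w x + c x) := ⟨ht.2, by have := ht.1; linarith⟩
            rw [indicator_of_mem ht, indicator_of_mem ht']
            simp
          · rw [indicator_of_notMem ht]
            exact zero_le
      _ ≤ ∫⁻ t, (Ico (w x) (w x + c x)).indicator 1 t := lintegral_mono' Measure.restrict_le_self le_rfl
      _ = volume (Ico (w x) (w x + c x)) := lintegral_indicator_one measurableSet_Ico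
      _ = ENNReal.ofReal (c x) := by rw [Real.volume_Ico]; ring_nf
  · rw [indicator_of_notMem hx]
    refine le_of_eq ?_
    have : ∀ t ∈ Ioo t₁ t₂, S.indicator (1 : ℝ × X → ℝ≥0∞) (t, x) = 0 := by
      intro t ht
      refine indicator_of_notMem (fun hts ↦ hx ?_) _
      obtain ⟨h1, h2⟩ := hts
      exact ⟨by have := ht.1; linarith, lt_of_le_of_lt h2 ht.2⟩
    rw [setLIntegral_congr_fun measurableSet_Ioo this, lintegral_zero]

/-! ### The slab inequality -/

set_option backward.isDefEq.respectTransparency false in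
/-- **The slab inequality from isoperimetry for the Minkowski content.** Let `(M, g)` be a smooth
Riemannian manifold with Riemannian distance `d` and Riemannian measure `μ`, and let
`Φ : [0,∞] → [0,∞]` be such that every Borel `Ω ⊆ M` with compact closure satisfies the
isoperimetric inequality `Φ(μ Ω) ≤ μ⁺(Ω) = liminf_{ε→0⁺} μ(Ω_ε ∖ Ω)/ε`,
`Ω_ε = {x | ∃ y ∈ Ω, d(x, y) < ε}` (the Minkowski content of Balogh–Kristály, Math. Ann. 2023,
Thm. 1.1 / Balogh–Kristály–Tripaldi 2024, (2.1)). Then for every smooth compactly supported `u` and all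
`0 ≤ t₁ < t₂`,
`∫_{t₁}^{t₂} Φ(μ{|u| > t}) dt ≤ ∫_{t₁ < |u| < t₂} |∇u|_g dμ`.
Proof: `minkowskiShell_subset_slab`, Tonelli (`lintegral_measure_slab_le`), Fatou along
`ε → 0⁺`, continuity of the measure from above, then `η → 0` and `t₁' ↓ t₁`; no coarea formula is
used. [cite: BaloghKristalyTripaldi2024, §2.1 (2.1)–(2.2) and §3.1] [cite: BaloghKristaly2022, Thm. 1.1 (hypothesis)] -/
theorem lintegral_isoperimetricProfile_le_lintegral_slab [T3Space M] [SecondCountableTopology M]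
    [MeasurableSpace M] [BorelSpace M] (hg : g.IsRiemannian) (Φ : ℝ≥0∞ → ℝ≥0∞)
    (hiso : ∀ Ω : Set M, MeasurableSet Ω → IsCompact (closure Ω) →
      Φ (riemannianMeasure (g.toContMDiffRiemannianMetric hg) Ω) ≤
        liminf (fun ε : ℝ ↦ riemannianMeasure (g.toContMDiffRiemannianMetric hg)
          ({x | ∃ y ∈ Ω, g.edist hg x y < ENNReal.ofReal ε} \ Ω) / ENNReal.ofReal ε) (𝓝[>] 0))
    {u : M → ℝ} (hu : ContMDiff I 𝓘(ℝ, ℝ) ∞ u) (hcu : HasCompactSupport u)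
    {t₁ t₂ : ℝ} (ht₁ : 0 ≤ t₁) (h12 : t₁ < t₂) :
    ∫⁻ t in Ioo t₁ t₂, Φ (riemannianMeasure (g.toContMDiffRiemannianMetric hg) {x | t < |u x|}) ≤
      ∫⁻ x in {x | t₁ < |u x| ∧ |u x| < t₂}, ENNReal.ofReal (Real.sqrt (g.gradSq u x))
        ∂(riemannianMeasure (g.toContMDiffRiemannianMetric hg)) := by
  set μ : Measure M := riemannianMeasure (g.toContMDiffRiemannianMetric hg) with hμ
  haveI : LocallyCompactSpace M := Manifold.locallyCompact_of_finiteDimensional I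
  haveI : IsFiniteMeasureOnCompacts μ :=
    ⟨fun K hK ↦ riemannianVolume_lt_top_of_isCompact_holds _ le_rfl hK⟩
  set ρ : M → ℝ := fun x ↦ Real.sqrt (g.gradSq u x) with hρ
  set w : M → ℝ := fun x ↦ |u x| with hw
  have huc : Continuous u := hu.continuous
  have hwm : Measurable w := huc.measurable.abs
  have hρc : Continuous ρ := Real.continuous_sqrt.comp (contMDiff_gradSq g hu).continuous
  have hρm : Measurable ρ := hρc.measurable
  have hρ0 : ∀ x, 0 ≤ ρ x := fun x ↦ Real.sqrt_nonneg _
  have hρs : HasCompactSupport ρ := by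
    refine hcu.mono' fun x hx ↦ ?_
    by_contra hx'
    apply hx
    change Real.sqrt (g.gradSq u x) = 0
    rw [gradSq_eq_zero_of_notMem_tsupport_of_boundaryless g hx', Real.sqrt_zero]
  obtain ⟨C, hC0, hC⟩ : ∃ C : ℝ, 0 ≤ C ∧ ∀ x, ρ x ≤ C := by
    obtain ⟨C, hC⟩ := hρc.bounded_above_of_compact_support hρs
    exact ⟨max C 0, le_max_right _ _, fun x ↦
      (le_trans (by simpa [Real.norm_eq_abs, abs_of_nonneg (hρ0 x)] using hC x) (le_max_left _ _))⟩
  -- superlevel sets of positive level have finite measure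
  have hfin : ∀ s : ℝ, 0 < s → μ {x | s < w x} < ⊤ := by
    intro s hs
    refine lt_of_le_of_lt (measure_mono fun x hx ↦ ?_) (hcu.isCompact.measure_lt_top (μ := μ))
    have hx' : s < |u x| := hx
    exact subset_tsupport u (Function.mem_support.2 (abs_pos.1 (hs.trans hx')))
  ----------------------------------------------------------------
  -- CORE: half-closed slab, with the slack `η`
  ----------------------------------------------------------------
  have core : ∀ s₁, t₁ < s₁ → s₁ < t₂ → ∀ η : ℝ, 0 < η →
      ∫⁻ t in Ioo s₁ t₂, Φ (μ {x | t < w x}) ≤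
        ∫⁻ x in {x | s₁ ≤ w x ∧ w x < t₂}, ENNReal.ofReal (ρ x + η) ∂μ := by
    intro s₁ hs₁ hs₂ η hη
    have hs₁pos : 0 < s₁ := lt_of_le_of_lt ht₁ hs₁
    obtain ⟨δ, hδ, hUC⟩ := exists_forall_edist_lt_sqrt_gradSq_le g hg hu hcu hη
    set c : ℝ → M → ℝ := fun ε x ↦ (ρ x + η) * ε with hc
    have hcm : ∀ ε, Measurable (c ε) := fun ε ↦ (hρm.add_const η).mul_const ε
    set B : ℝ → ℝ → ℝ≥0∞ := fun ε t ↦ μ {x | t - c ε x < w x ∧ w x ≤ t} / ENNReal.ofReal ε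
      with hB
    -- (a) pointwise in `t`: isoperimetry and the shell inclusion
    have stepA : ∀ t ∈ Ioo s₁ t₂, Φ (μ {x | t < w x}) ≤ liminf (fun ε ↦ B ε t) (𝓝[>] 0) := by
      intro t ht
      have htpos : 0 < t := hs₁pos.trans ht.1
      have hΩm : MeasurableSet {x | t < w x} := measurableSet_lt measurable_const hwm
      have hΩc : IsCompact (closure {x | t < w x}) := by
        refine hcu.of_isClosed_subset isClosed_closure (closure_mono fun x hx ↦ ?_)
        have hx' : t < |u x| := hx
        exact Function.mem_support.2 (abs_pos.1 (htpos.trans hx'))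
      refine (hiso _ hΩm hΩc).trans (liminf_le_liminf ?_)
      have hev : ∀ᶠ ε in 𝓝[>] (0 : ℝ), ε ∈ Ioo 0 δ := Ioo_mem_nhdsGT hδ
      filter_upwards [hev] with ε hε
      have hUCε : ∀ x z, g.edist hg x z < ENNReal.ofReal ε → ρ z ≤ ρ x + η := fun x z hxz ↦
        hUC x z (hxz.trans_le (ENNReal.ofReal_le_ofReal hε.2.le))
      have hsub := minkowskiShell_subset_slab g hg (hu.of_le (by exact_mod_cast le_top)) hη.le
        hUCε t
      refine ENNReal.div_le_div_right (measure_mono ?_) _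
      refine Subset.trans ?_ hsub
      rintro x ⟨⟨y, hy, hxy⟩, hx⟩
      exact ⟨⟨y, hy, hxy⟩, hx⟩
    -- (b) measurability of `B ε` in `t` (sections of a measurable subset of `ℝ × M`)
    have hSm : ∀ ε, MeasurableSet {p : ℝ × M | p.1 - c ε p.2 < w p.2 ∧ w p.2 ≤ p.1} := fun ε ↦
      (measurableSet_lt (measurable_fst.sub ((hcm ε).comp measurable_snd))
        (hwm.comp measurable_snd)).inter (measurableSet_le (hwm.comp measurable_snd) measurable_fst)
    have hmeas : ∀ ε, Measurable fun t ↦ μ {x | t - c ε x < w x ∧ w x ≤ t} := fun ε ↦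
      measurable_measure_prodMk_left (hSm ε)
    have hBm : ∀ ε, Measurable (B ε) := fun ε ↦ (hmeas ε).div_const _
    -- (c) the bound after Tonelli, and its limit as `ε → 0⁺`
    set A : ℝ → Set M := fun ε ↦ {x | s₁ - (C + η) * ε < w x ∧ w x < t₂} with hA
    have hAm : ∀ ε, MeasurableSet (A ε) := fun ε ↦
      (measurableSet_lt measurable_const hwm).inter (measurableSet_lt hwm measurable_const)
    set ν : Measure M := μ.withDensity fun x ↦ ENNReal.ofReal (ρ x + η) with hν
    have hνA : ∀ ε, ν (A ε) = ∫⁻ x in A ε, ENNReal.ofReal (ρ x + η) ∂μ := fun ε ↦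
      withDensity_apply _ (hAm ε)
    have stepC : ∀ ε ∈ Ioo (0 : ℝ) δ, ∫⁻ t in Ioo s₁ t₂, B ε t ≤ ν (A ε) := by
      intro ε hε
      have hε0 : ENNReal.ofReal ε ≠ 0 := (ENNReal.ofReal_pos.2 hε.1).ne'
      have hεT : ENNReal.ofReal ε ≠ ⊤ := ENNReal.ofReal_ne_top
      have hTon := lintegral_measure_slab_le μ hwm (hcm ε) s₁ t₂
      -- `c ε x ≤ (C + η) ε`, so the set grows and the integrand factors
      have hmono : {x | s₁ - c ε x < w x ∧ w x < t₂} ⊆ A ε := by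
        rintro x ⟨h1, h2⟩
        refine ⟨lt_of_le_of_lt ?_ h1, h2⟩
        have : c ε x ≤ (C + η) * ε :=
          mul_le_mul_of_nonneg_right (by linarith [hC x]) hε.1.le
        linarith
      calc ∫⁻ t in Ioo s₁ t₂, B ε t
          = (∫⁻ t in Ioo s₁ t₂, μ {x | t - c ε x < w x ∧ w x ≤ t}) / ENNReal.ofReal ε := by
            simp only [hB, div_eq_mul_inv]
            rw [lintegral_mul_const _ (hmeas ε)]
        _ ≤ (∫⁻ x in {x | s₁ - c ε x < w x ∧ w x < t₂}, ENNReal.ofReal (c ε x) ∂μ) /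
              ENNReal.ofReal ε := ENNReal.div_le_div_right hTon _
        _ ≤ (∫⁻ x in A ε, ENNReal.ofReal (c ε x) ∂μ) / ENNReal.ofReal ε :=
            ENNReal.div_le_div_right (lintegral_mono_set hmono) _
        _ = (∫⁻ x in A ε, ENNReal.ofReal (ρ x + η) * ENNReal.ofReal ε ∂μ) / ENNReal.ofReal ε := by
            congr 1
            refine setLIntegral_congr_fun (hAm ε) fun x _ ↦ ?_
            rw [hc, ENNReal.ofReal_mul (add_nonneg (hρ0 x) hη.le)]
        _ = ν (A ε) := by
            rw [lintegral_mul_const _ (by fun_prop), hνA, mul_div_assoc,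
              ENNReal.div_self hε0 hεT, mul_one]
    -- the limit of `ν (A ε)` as `ε → 0⁺` is `ν {s₁ ≤ w < t₂}`
    have hlim : Tendsto (fun ε ↦ ν (A ε)) (𝓝[>] 0)
        (𝓝 (ν {x | s₁ ≤ w x ∧ w x < t₂})) := by
      have hInter : (⋂ r > (0 : ℝ), A r) = {x | s₁ ≤ w x ∧ w x < t₂} := by
        ext x
        simp only [mem_iInter, mem_setOf_eq, hA]
        constructor
        · intro hx
          have h2 : w x < t₂ := (hx 1 one_pos).2
          refine ⟨?_, h2⟩
          by_contra hlt
          rw [not_le] at hlt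
          have hCη : 0 < C + η := by linarith
          obtain ⟨r, hr0, hr⟩ : ∃ r : ℝ, 0 < r ∧ (C + η) * r < s₁ - w x :=
            ⟨(s₁ - w x) / (2 * (C + η)), by positivity, by
              rw [mul_div_assoc']
              rw [div_lt_iff₀ (by positivity)]
              nlinarith⟩
          have := (hx r hr0).1
          linarith
        · rintro ⟨h1, h2⟩ r hr
          have hCη : 0 < (C + η) * r := mul_pos (by linarith) hr
          exact ⟨by linarith, h2⟩
      rw [← hInter]
      refine tendsto_measure_biInter_gt (fun r _ ↦ (hAm r).nullMeasurableSet)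
        (fun i j hi hij ↦ ?_) ?_
      · rintro x ⟨h1, h2⟩
        have hCη : 0 ≤ C + η := by linarith
        exact ⟨by nlinarith, h2⟩
      · -- finiteness: for `r` small, `A r ⊆ {w > s₁/2}`, a set of finite measure
        have hCη : 0 < C + η := by linarith
        refine ⟨s₁ / (2 * (C + η)), by positivity, ?_⟩
        have hsub : A (s₁ / (2 * (C + η))) ⊆ {x | s₁ / 2 < w x} := by
          rintro x ⟨h1, -⟩
          have : (C + η) * (s₁ / (2 * (C + η))) = s₁ / 2 := by field_simp
          change s₁ / 2 < w x
          linarith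
        refine ne_of_lt (lt_of_le_of_lt ((hνA _).le.trans (lintegral_mono_set hsub)) ?_)
        calc ∫⁻ x in {x | s₁ / 2 < w x}, ENNReal.ofReal (ρ x + η) ∂μ
            ≤ ∫⁻ x in {x | s₁ / 2 < w x}, ENNReal.ofReal (C + η) ∂μ :=
              lintegral_mono fun x ↦ ENNReal.ofReal_le_ofReal (by linarith [hC x])
          _ = ENNReal.ofReal (C + η) * μ {x | s₁ / 2 < w x} := setLIntegral_const _ _
          _ < ⊤ := ENNReal.mul_lt_top ENNReal.ofReal_lt_top (hfin _ (half_pos hs₁pos))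
    have hA0m : MeasurableSet {x | s₁ ≤ w x ∧ w x < t₂} :=
      (measurableSet_le measurable_const hwm).inter (measurableSet_lt hwm measurable_const)
    -- conclude the core estimate
    calc ∫⁻ t in Ioo s₁ t₂, Φ (μ {x | t < w x})
        ≤ ∫⁻ t in Ioo s₁ t₂, liminf (fun ε ↦ B ε t) (𝓝[>] 0) :=
          setLIntegral_mono' measurableSet_Ioo fun t ht ↦ stepA t ht
      _ ≤ liminf (fun ε ↦ ∫⁻ t in Ioo s₁ t₂, B ε t) (𝓝[>] 0) :=
          lintegral_liminf_le fun ε ↦ hBm ε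
      _ ≤ liminf (fun ε ↦ ν (A ε)) (𝓝[>] 0) :=
          liminf_le_liminf (by
            filter_upwards [Ioo_mem_nhdsGT hδ] with ε hε using stepC ε hε)
      _ = ν {x | s₁ ≤ w x ∧ w x < t₂} := hlim.liminf_eq
      _ = ∫⁻ x in {x | s₁ ≤ w x ∧ w x < t₂}, ENNReal.ofReal (ρ x + η) ∂μ :=
          withDensity_apply _ hA0m
  ----------------------------------------------------------------
  -- `η → 0`
  ----------------------------------------------------------------
  have core2 : ∀ s₁, t₁ < s₁ → s₁ < t₂ →
      ∫⁻ t in Ioo s₁ t₂, Φ (μ {x | t < w x}) ≤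
        ∫⁻ x in {x | t₁ < w x ∧ w x < t₂}, ENNReal.ofReal (ρ x) ∂μ := by
    intro s₁ hs₁ hs₂
    have hs₁pos : 0 < s₁ := lt_of_le_of_lt ht₁ hs₁
    set A₀ : Set M := {x | s₁ ≤ w x ∧ w x < t₂} with hA₀
    have hA₀m : MeasurableSet A₀ :=
      (measurableSet_le measurable_const hwm).inter (measurableSet_lt hwm measurable_const)
    have hA₀fin : μ A₀ < ⊤ := by
      refine lt_of_le_of_lt (measure_mono fun x hx ↦ ?_) (hfin _ (half_pos hs₁pos))
      have h1 : s₁ ≤ w x := hx.1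
      change s₁ / 2 < w x
      linarith
    have hA₀sub : A₀ ⊆ {x | t₁ < w x ∧ w x < t₂} := fun x hx ↦ ⟨hs₁.trans_le hx.1, hx.2⟩
    refine ENNReal.le_of_forall_pos_le_add fun ε hε _ ↦ ?_
    set η : ℝ := (ε : ℝ) / ((μ A₀).toReal + 1) with hηdef
    have hη : 0 < η := by positivity
    have hηb : ENNReal.ofReal η * μ A₀ ≤ ε := by
      rw [← ENNReal.ofReal_toReal hA₀fin.ne, ← ENNReal.ofReal_mul hη.le]
      have hle : η * (μ A₀).toReal ≤ ε := by
        rw [hηdef, div_mul_eq_mul_div, div_le_iff₀ (by positivity)]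
        nlinarith [ENNReal.toReal_nonneg (a := μ A₀), NNReal.coe_nonneg ε]
      calc ENNReal.ofReal (η * (μ A₀).toReal) ≤ ENNReal.ofReal ε := ENNReal.ofReal_le_ofReal hle
        _ = ε := ENNReal.ofReal_coe_nnreal
    calc ∫⁻ t in Ioo s₁ t₂, Φ (μ {x | t < w x})
        ≤ ∫⁻ x in A₀, ENNReal.ofReal (ρ x + η) ∂μ := core s₁ hs₁ hs₂ η hη
      _ = ∫⁻ x in A₀, ENNReal.ofReal (ρ x) + ENNReal.ofReal η ∂μ := by
          refine setLIntegral_congr_fun hA₀m fun x _ ↦ ?_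
          rw [ENNReal.ofReal_add (hρ0 x) hη.le]
      _ = (∫⁻ x in A₀, ENNReal.ofReal (ρ x) ∂μ) + ENNReal.ofReal η * μ A₀ := by
          rw [lintegral_add_right _ measurable_const, setLIntegral_const]
      _ ≤ (∫⁻ x in {x | t₁ < w x ∧ w x < t₂}, ENNReal.ofReal (ρ x) ∂μ) + ε :=
          add_le_add (lintegral_mono_set hA₀sub) hηb
  ----------------------------------------------------------------
  -- `s₁ ↓ t₁`
  ----------------------------------------------------------------
  set d : ℕ → ℝ := fun k ↦ (t₂ - t₁) / ((k : ℝ) + 2) with hd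
  have hdpos : ∀ k, 0 < d k := fun k ↦ by
    have : 0 < t₂ - t₁ := by linarith
    positivity
  have hdlt : ∀ k, t₁ + d k < t₂ := by
    intro k
    have h0 : 0 < t₂ - t₁ := by linarith
    have : d k < t₂ - t₁ := by
      rw [hd, div_lt_iff₀ (by positivity)]
      nlinarith [(k.cast_nonneg : (0 : ℝ) ≤ k)]
    linarith
  have hU : Ioo t₁ t₂ = ⋃ k : ℕ, Ioo (t₁ + d k) t₂ := by
    ext t
    simp only [mem_iUnion, mem_Ioo]
    constructor
    · rintro ⟨h1, h2⟩
      have htpos : 0 < t - t₁ := by linarith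
      obtain ⟨k, hk⟩ := exists_nat_gt ((t₂ - t₁) / (t - t₁))
      refine ⟨k, ?_, h2⟩
      have hk' : t₂ - t₁ < k * (t - t₁) := by rwa [div_lt_iff₀ htpos] at hk
      have : d k < t - t₁ := by
        rw [hd, div_lt_iff₀ (by positivity)]
        nlinarith
      linarith
    · rintro ⟨k, h1, h2⟩
      exact ⟨by linarith [hdpos k], h2⟩
  have hdir : Directed (· ⊆ ·) fun k : ℕ ↦ Ioo (t₁ + d k) t₂ := by
    refine Monotone.directed_le fun k l hkl ↦ Ioo_subset_Ioo ?_ le_rfl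
    have h0 : 0 ≤ t₂ - t₁ := by linarith
    have : d l ≤ d k := by
      rw [hd]
      exact div_le_div_of_nonneg_left h0 (by positivity)
        (by simpa using (Nat.cast_le.2 hkl : (k : ℝ) ≤ l))
    linarith
  rw [hU, setLIntegral_iUnion_of_directed _ hdir]
  exact iSup_le fun k ↦ core2 _ (by linarith [hdpos k]) (hdlt k)

end Slab

end Literature.Geometry.Riemannian

end
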